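import Literature.MathematicalPhysics.QuantumFieldTheory.Balaban1983to89.B9Thm311ClassKeyedHunitANotInhabited
import Literature.MathematicalPhysics.QuantumFieldTheory.Balaban1983to89.B9SectBL2SecondOrderY
import Literature.MathematicalPhysics.QuantumFieldTheory.Balaban1983to89.B9SectBGWordCurlHolY

/-!
# Balaban [B9], (3.69) p. 404 (the text after it) ∕ (3.35) p. 396 — THE THRESHOLD-FREE L² PLAQUETTE DISPLAY «`PlaqLawY cP U` for every (3.35)-regular `U`, EVERY `α₀`»
# IS NOT INHABITED at `SU(N)` as soon as the member has a block of scale `s` with `L^{2s} > cP∕2` — a kernel certificate for LOCATED-17 of seat dag-n06-c g17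
# (pub-ymgap N06, FLAG №8, director-ym №290 (1)(a)∕(d))

T. Bałaban, *Propagators for lattice gauge theories in a background field*, Commun. Math. Phys. **99** (1985) 389–434 [`Balaban1985BackgroundPropagators`, "B9"],
(3.35) p. 396, p. 404 (after (3.69)), Thm 3.1 p. 397 («with Mα₀ ≦ a₀»).

statement-level skeleton of published theorems with citation tags; proofs where landed; nothing here is a claim about the Yang–Mills mass gap

v1.1 — DOC-ONLY EDITION (lit-balaban-r06 №93 artefact l.6 «page-before-label» + referee ref-E g31 READ-6 nit): title locator re-ordered; every declaration byte-identical to v1.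

WHY THIS FILE.  `B9SectBStepUOfMembers[R].sectBStepU_C37GY_unitary_of_members` displays `hplaq : ∀ j α₀ U, (carrier).Reg335 c35 α₀ U → PlaqLawY (f j) (ιB j) cP U` with ONE
`cP` for every member and EVERY `α₀` (LOCATED-17; director-ym №290 (1)(a): adopted as a located reading; cured by the GUARDED binder of `B9SectBStepUGuardedR`).  THIS
FILE is the kernel certificate, in the honest CONDITIONAL form: at any member `x` that has a site `z` whose block scale `s` satisfies `cP < 2·L^{2s}` (every UV family
has such members for every `cP`), the display's instance at `x` is FALSE for `G ∋ gSU N`, `N ≥ 2`, `d + 1 ≥ 2`.  WITNESS: dag-n06-j's half-frustrated background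
`halfCfg x (gSU N)` — (3.35)-regular at the record's reading of print's class for `α₀ ≥ T⋆` (dag-n06-c `B9Thm311ClassKeyedHunitANotInhabited.reg335C_extraYPb_halfCfg_of_le`)
— and the test matrix `X := R(b⁻¹) E₀₁` at the plaquette `p₀₁(z)`: the two transports around the plaquette differ by conjugation with its holonomy `P ∈ {g, g⁻¹}`
(`holY_halfCfg`), and `R(g^{±1}) E₀₁ = −E₀₁` (`g = diag(i, −i, 1, …)`), so the left side of `PlaqLawY` is `2‖E₀₁‖` while the right side is `cP·L^{−2s}·‖X‖ ≤
cP·L^{−2s}·‖E₀₁‖ < 2‖E₀₁‖`.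

WHAT IS PROVED (kernel-checked; 0 `sorry`; 1 small `def`: the test matrix `eOff01`).
* §1 `eOff01` (`E₀₁`), `eOff01_ne_zero`, ★ `R_gSU_eOff01` ∕ `R_gSU_inv_eOff01` (`= −eOff01`).
* §2 ★ `transports_eq_R_plaq` (the two transports of `PlaqLawY` differ by `R` of the plaquette unit `plaqU`), `plaqU_halfCfg` (`∈ {g, g⁻¹}` at NODE 00's letters).
* §3 ★★★ `not_plaqLawY_halfCfg` (`cP < 2·L^{2·scale Δ(z)}` ⇒ `¬ PlaqLawY x ιB cP (halfCfg …)`), ★★★ `not_hplaq_unguarded` — `¬ ∀ α₀ U, (bg9YC (M_N ℂ) G extraYPb x).Reg335 c35 α₀ U →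
  PlaqLawY x ιB cP U` under that scale hypothesis, and the family form ★★★ `not_hplaq_classKeyed` (VERBATIM the `hplaq` binder of p724076 at `P := extraYPb`, negated,
  given ONE member `j₀` with such a block).

HONEST SCOPE.  A certificate about a DISPLAYED HYPOTHESIS (typing) in a conditional form (the scale hypothesis is stated, not constructed); nothing against [B9] (print
asks (3.35) only with `Mα₀ ≦ a₀`); count-neutral; N06 NOT discharged; nothing continuum ∕ OS ∕ mass gap ∕ Clay.  Cell `pub-ymgap` (HUMAN RULING D-0062), Track A node N06
[B9], seat `pub-ymgap-dag-n06-c` g17, 2026-08-29.  NEW file; nothing landed is modified.  Net new unproved facts: 0.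
-/

noncomputable section

namespace Literature.MathematicalPhysics.QuantumFieldTheory.Balaban1983to89.B9SectBL2PlaqLawUnguardedNotInhabited

open Literature.MathematicalPhysics.QuantumFieldTheory.Balaban1983to89
open Node00 B6KLevelCensusIndexV1 B9BackgroundsKLevelV1 B6GlobalChartV1
open Literature.MathematicalPhysics.QuantumFieldTheory.Balaban1983to89.B7Prop2SpecialUnitary (specialUnitaryUnits)
open Literature.MathematicalPhysics.QuantumFieldTheory.Balaban1983to89.B9Eq39Adjoint (R R_def R_mul plaqU)
open Literature.MathematicalPhysics.QuantumFieldTheory.Balaban1983to89.B9Thm311DeltaANotUnitWitness (halfCfg halfCfg_mem suDiag gSU gSU_mem_specialUnitaryUnits holY_halfCfg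
  star_suDiag_mul suDiag_mul_star)
open Literature.MathematicalPhysics.QuantumFieldTheory.Balaban1983to89.B9Thm311ClassKeyedHunitANotInhabited (alpha0Star335 reg335C_extraYPb_halfCfg_of_le)
open Literature.MathematicalPhysics.QuantumFieldTheory.Balaban1983to89.B9PinMembersKLevelV1 (MemberY geo9Y)
open Literature.MathematicalPhysics.QuantumFieldTheory.Balaban1983to89.B9PinGeometryKLevelV1 (c35Y)
open Literature.MathematicalPhysics.QuantumFieldTheory.Balaban1983to89.B9GeoNormsKLevelV1 (geo9K)
open Literature.MathematicalPhysics.QuantumFieldTheory.Balaban1983to89.B9SectBCodedClassR (RegExtraY bg9YC extraYPb)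
open Literature.MathematicalPhysics.QuantumFieldTheory.Balaban1983to89.B9SectBGpLettersY (GVal blkC norm_le_one_and_inv_of_mem)
open Literature.MathematicalPhysics.QuantumFieldTheory.Balaban1983to89.B9SectBL2SecondOrderY (PlaqLawY)
open Literature.MathematicalPhysics.QuantumFieldTheory.Balaban1983to89.B9SectBGWordCurlHolY (holY_eq_plaqU)
open Literature.MathematicalPhysics.QuantumFieldTheory.Balaban1983to89.Node00.OpsYNablaBridge (chartY)
open scoped Matrix

/-! ## §1 The test matrix `E₀₁` and its conjugates by `g^{±1}` -/

section Test

variable (N : ℕ)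

/-- the matrix unit `E₀₁`. [cite: Balaban1985BackgroundPropagators, (3.39) p.397 (directions), dictionary] -/
def eOff01 : Matrix (Fin N) (Fin N) ℂ := fun i j => if (i : ℕ) = 0 ∧ (j : ℕ) = 1 then 1 else 0

/-- `E₀₁ ≠ 0` for `N ≥ 2`. [cite: Balaban1985BackgroundPropagators, (3.39) p.397, bookkeeping] -/
theorem eOff01_ne_zero (hN : 2 ≤ N) : eOff01 N ≠ 0 := by
  intro h
  have h0 := congr_fun (congr_fun h ⟨0, by omega⟩) ⟨1, by omega⟩
  simp [eOff01] at h0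

/-- `g E₀₁ g⁻¹ = −E₀₁` for `g = diag(i, −i, 1, …)` (entry `(0,1)`: `i · conj(−i) = i·i = −1`). [cite: Balaban1985BackgroundPropagators, (3.2) p.390 (R(U)), bookkeeping] -/
theorem R_gSU_eOff01 : R (gSU N) (eOff01 N) = -eOff01 N := by
  rw [R_def]
  show Matrix.diagonal (suDiag N) * eOff01 N * Matrix.diagonal (star (suDiag N)) = -eOff01 N
  ext a b
  rw [Matrix.mul_diagonal, Matrix.diagonal_mul, Matrix.neg_apply]
  unfold eOff01 suDiag
  by_cases hab : (a : ℕ) = 0 ∧ (b : ℕ) = 1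
  · simp only [hab, and_self, if_true, if_false, Pi.star_apply, Complex.star_def, one_ne_zero, map_neg, Complex.conj_I,
      mul_one, neg_neg, Complex.I_mul_I]
  · simp only [hab, if_false, mul_zero, zero_mul, neg_zero]

/-- `g⁻¹ E₀₁ g = −E₀₁` likewise. [cite: Balaban1985BackgroundPropagators, (3.2) p.390, bookkeeping] -/
theorem R_gSU_inv_eOff01 : R (gSU N)⁻¹ (eOff01 N) = -eOff01 N := by
  rw [R_def, inv_inv]
  show Matrix.diagonal (star (suDiag N)) * eOff01 N * Matrix.diagonal (suDiag N) = -eOff01 N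
  ext a b
  rw [Matrix.mul_diagonal, Matrix.diagonal_mul, Matrix.neg_apply]
  unfold eOff01 suDiag
  by_cases hab : (a : ℕ) = 0 ∧ (b : ℕ) = 1
  · simp only [hab, and_self, if_true, if_false, Pi.star_apply, Complex.star_def, one_ne_zero, Complex.conj_I,
      mul_one, neg_mul, mul_neg, neg_neg, Complex.I_mul_I]
  · simp only [hab, if_false, mul_zero, zero_mul, neg_zero]

end Test

/-! ## §2 The two transports of `PlaqLawY` differ by the plaquette unit -/

section Transports

variable {𝔸 : Type} [NormedRing 𝔸]

/-- ★ with `a := V_μ(z)V_ν(z+e_μ)`, `b := V_ν(z)V_μ(z+e_ν)` and `P := plaqU T V μ ν z = a·b⁻¹`: `R(a)(R(b⁻¹)Y) − R(b)(R(b⁻¹)Y) = R(P)Y − Y`.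
[cite: Balaban1985BackgroundPropagators, (3.2) p.390, (3.5)–(3.7) p.391] -/
theorem transports_eq_R_plaq {S : Type} {ι : Type} (T : ι → Equiv.Perm S) (V : ι → S → 𝔸ˣ) (μ ν : ι) (z : S) (Y : 𝔸) :
    R (V μ z * V ν (T μ z)) (R (V ν z * V μ (T ν z))⁻¹ Y) - R (V ν z * V μ (T ν z)) (R (V ν z * V μ (T ν z))⁻¹ Y) = R (plaqU T V μ ν z) Y - Y := by
  have h1 : R (V ν z * V μ (T ν z)) (R (V ν z * V μ (T ν z))⁻¹ Y) = Y := by rw [← B9Eq39Adjoint.R_mul, mul_inv_cancel, B9Eq39Adjoint.R_one]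
  have h2 : R (V μ z * V ν (T μ z)) (R (V ν z * V μ (T ν z))⁻¹ Y) = R (plaqU T V μ ν z) Y := by
    rw [← B9Eq39Adjoint.R_mul, plaqU, mul_inv_rev, ← mul_assoc]
  rw [h1, h2]

end Transports

/-! ## §3 ★★★ The unguarded `hplaq` is not inhabited at a member with a block of scale `s`, `L^{2s} > cP∕2` -/

section NotInhabited

open scoped Matrix.Norms.L2Operator

variable {d ℓ : ℕ} {hd : 1 ≤ d + 1} {hL : Odd (ℓ + 1) ∧ 1 < ℓ + 1} {b₀ b₁ : ℝ} {Mstar N : ℕ}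

/-- at NODE 00's letters the plaquette unit of the half-frustrated background is `g` or `g⁻¹`. [cite: Balaban1985BackgroundPropagators, (3.7) p.391] -/
theorem plaqU_halfCfg (i : KIdx d ℓ hd hL b₀ b₁) (g : (Matrix (Fin N) (Fin N) ℂ)ˣ) {μ ν : Fin (d + 1)} (hμν : μ < ν) (z : SiteY i) :
    plaqU (shiftY i) (UboxY i (halfCfg i g)) μ ν z = g ∨ plaqU (shiftY i) (UboxY i (halfCfg i g)) μ ν z = g⁻¹ := by
  have h := holY_halfCfg i g ⟨(chartY i).symm z, μ, ν, hμν⟩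
  rwa [holY_eq_plaqU, Equiv.apply_symm_apply] at h

/-- ★★★ **`PlaqLawY cP` FAILS AT THE HALF-FRUSTRATED BACKGROUND** whenever the member has a site `z` with `cP < 2·L^{2·scale Δ(z)}` (`N ≥ 2`, `d + 1 ≥ 2`,
`G ∋ g = gSU N` contracting): at the plaquette `p₀₁(z)` and `X := R(b⁻¹)E₀₁` the left side of the law is `‖R(g^{±1})E₀₁ − E₀₁‖ = 2‖E₀₁‖`, the right side
`≤ cP·L^{−2s}·‖E₀₁‖`. [cite: Balaban1985BackgroundPropagators, p.404 (after (3.69)), (3.35) p.396] -/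
theorem not_plaqLawY_halfCfg (x : MemberY d ℓ hd hL b₀ b₁ Mstar) (ιB : BlkY x.toKIdx → IBondY x.toKIdx) (hd1 : 1 ≤ d) (hN : 2 ≤ N)
    {G : Subgroup (Matrix (Fin N) (Fin N) ℂ)ˣ} (hG1 : ∀ u : (Matrix (Fin N) (Fin N) ℂ)ˣ, u ∈ G → ‖(u : Matrix (Fin N) (Fin N) ℂ)‖ ≤ 1) (hg : gSU N ∈ G)
    {cP : ℝ} (z : SiteY x.toKIdx) (hz : cP < 2 * ((geo9Y x).L ^ (geo9Y x).scale (blkC x.toKIdx ιB z)) ^ 2) :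
    ¬ PlaqLawY x ιB cP (halfCfg x.toKIdx (gSU N)) := by
  intro h
  let V : Fin (d + 1) → SiteY x.toKIdx → (Matrix (Fin N) (Fin N) ℂ)ˣ := UboxY x.toKIdx (halfCfg x.toKIdx (gSU N))
  let μ : Fin (d + 1) := ⟨0, by omega⟩
  let ν : Fin (d + 1) := ⟨1, by omega⟩
  have hμν : μ < ν := Fin.mk_lt_mk.2 zero_lt_one
  let bU : (Matrix (Fin N) (Fin N) ℂ)ˣ := V ν z * V μ (shiftY x.toKIdx ν z)
  have key : ‖R (V μ z * V ν (shiftY x.toKIdx μ z)) (R bU⁻¹ (eOff01 N)) - R (V ν z * V μ (shiftY x.toKIdx ν z)) (R bU⁻¹ (eOff01 N))‖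
      ≤ cP * ((kGeo x.toKIdx).eta * ((geo9Y x).len (blkC x.toKIdx ιB z))⁻¹) ^ 2 * ‖R bU⁻¹ (eOff01 N)‖ := h μ ν z (R bU⁻¹ (eOff01 N))
  rw [transports_eq_R_plaq] at key
  -- the left side: `R(P) E₀₁ − E₀₁ = −2·E₀₁`
  have hP : R (plaqU (shiftY x.toKIdx) V μ ν z) (eOff01 N) = -eOff01 N := by
    rcases plaqU_halfCfg x.toKIdx (gSU N) hμν z with hP | hP
    · rw [hP, R_gSU_eOff01]
    · rw [hP, R_gSU_inv_eOff01]
  rw [hP, show -eOff01 N - eOff01 N = (-2 : ℂ) • eOff01 N by rw [neg_smul, two_smul]; abel, norm_smul] at key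
  -- the right side: `‖R(b⁻¹)E₀₁‖ ≤ ‖E₀₁‖` (`b` is `G`-valued, `G` contracting)
  have hbG : bU ∈ G := mul_mem (halfCfg_mem x.toKIdx (gSU N) hg _ _) (halfCfg_mem x.toKIdx (gSU N) hg _ _)
  have hX : ‖R bU⁻¹ (eOff01 N)‖ ≤ ‖eOff01 N‖ := by
    rw [R_def, inv_inv]
    obtain ⟨hb1, hb2⟩ := norm_le_one_and_inv_of_mem G hG1 hbG
    calc _ ≤ ‖(((bU⁻¹ : (Matrix (Fin N) (Fin N) ℂ)ˣ)) : Matrix (Fin N) (Fin N) ℂ) * eOff01 N‖ * ‖((bU : (Matrix (Fin N) (Fin N) ℂ)ˣ) : Matrix (Fin N) (Fin N) ℂ)‖ :=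
          norm_mul_le _ _
      _ ≤ (‖(((bU⁻¹ : (Matrix (Fin N) (Fin N) ℂ)ˣ)) : Matrix (Fin N) (Fin N) ℂ)‖ * ‖eOff01 N‖) * 1 :=
          mul_le_mul (norm_mul_le _ _) hb1 (norm_nonneg _) (by positivity)
      _ ≤ (1 * ‖eOff01 N‖) * 1 := by gcongr
      _ = ‖eOff01 N‖ := by ring
  -- the scale factor: `(η·ℓ(Δ(z))⁻¹)² = (L^{s})⁻²`
  have hη : 0 < (geo9K x.toKIdx).eta := B9Eq335PlaquetteAtLettersY.eta_pos x.toKIdx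
  have hL1 : (1 : ℝ) ≤ (geo9K x.toKIdx).L := B9Eq335PlaquetteAtLettersY.one_le_L x.toKIdx
  have hLs : 0 < (geo9Y x).L ^ (geo9Y x).scale (blkC x.toKIdx ιB z) := pow_pos (lt_of_lt_of_le one_pos hL1) _
  have hfac : ((kGeo x.toKIdx).eta * ((geo9Y x).len (blkC x.toKIdx ιB z))⁻¹) ^ 2 = (((geo9Y x).L ^ (geo9Y x).scale (blkC x.toKIdx ιB z)) ^ 2)⁻¹ := by
    have e1 : (geo9Y x).len (blkC x.toKIdx ιB z) = (geo9Y x).L ^ (geo9Y x).scale (blkC x.toKIdx ιB z) * (geo9K x.toKIdx).eta := rfl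
    have e2 : (kGeo x.toKIdx).eta = (geo9K x.toKIdx).eta := rfl
    rw [e1, e2, mul_inv, ← mul_assoc, mul_comm ((geo9K x.toKIdx).eta) _, mul_assoc, mul_inv_cancel₀ (ne_of_gt hη), mul_one, inv_pow]
  rw [hfac] at key
  have hE : 0 < ‖eOff01 N‖ := norm_pos_iff.2 (eOff01_ne_zero N hN)
  have hcP : cP * (((geo9Y x).L ^ (geo9Y x).scale (blkC x.toKIdx ιB z)) ^ 2)⁻¹ < 2 := by
    rw [mul_inv_lt_iff₀ (pow_pos hLs 2)]; linarith
  have hn2 : ‖(-2 : ℂ)‖ = 2 := by simp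
  rw [hn2] at key
  have : cP * (((geo9Y x).L ^ (geo9Y x).scale (blkC x.toKIdx ιB z)) ^ 2)⁻¹ * ‖R bU⁻¹ (eOff01 N)‖ < 2 * ‖eOff01 N‖ := by
    by_cases hc : 0 ≤ cP * (((geo9Y x).L ^ (geo9Y x).scale (blkC x.toKIdx ιB z)) ^ 2)⁻¹
    · calc _ ≤ cP * (((geo9Y x).L ^ (geo9Y x).scale (blkC x.toKIdx ιB z)) ^ 2)⁻¹ * ‖eOff01 N‖ := mul_le_mul_of_nonneg_left hX hc
        _ < 2 * ‖eOff01 N‖ := mul_lt_mul_of_pos_right hcP hE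
    · push Not at hc
      exact lt_of_le_of_lt (mul_nonpos_of_nonpos_of_nonneg hc.le (norm_nonneg _)) (by positivity)
  linarith

/-- ★★★ **THE UNGUARDED `hplaq` AT THE RECORD's READING OF PRINT's CLASS IS NOT INHABITED — ONE MEMBER** (`P := extraYPb`, slot `c35` inert; `N ≥ 2`, `d + 1 ≥ 2`,
`G ∋ gSU N` contracting; the member has a site `z` with `cP < 2·L^{2·scale Δ(z)}`): the half-frustrated background is (3.35)-regular at a large `α₀`
(`reg335C_extraYPb_halfCfg_of_le`) and violates `PlaqLawY cP` there. [cite: Balaban1985BackgroundPropagators, Thm 3.1 p.397 («with Mα₀ ≦ a₀» — the threshold the display omits), p.404, (3.35) p.396] -/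
theorem not_hplaq_unguarded (x : MemberY d ℓ hd hL b₀ b₁ Mstar) (ιB : BlkY x.toKIdx → IBondY x.toKIdx) (hd1 : 1 ≤ d) (hN : 2 ≤ N)
    {G : Subgroup (Matrix (Fin N) (Fin N) ℂ)ˣ} (hG1 : ∀ u : (Matrix (Fin N) (Fin N) ℂ)ˣ, u ∈ G → ‖(u : Matrix (Fin N) (Fin N) ℂ)‖ ≤ 1) (hg : gSU N ∈ G)
    (c35 : ℝ) {cP : ℝ} (z : SiteY x.toKIdx) (hz : cP < 2 * ((geo9Y x).L ^ (geo9Y x).scale (blkC x.toKIdx ιB z)) ^ 2) :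
    ¬ ∀ (α₀ : ℝ) (U : CfgY (Matrix (Fin N) (Fin N) ℂ) x.toKIdx),
      (bg9YC (Matrix (Fin N) (Fin N) ℂ) G (extraYPb (d := d) (ℓ := ℓ) (hd := hd) (hL := hL) (b₀ := b₀) (b₁ := b₁) (Mstar := Mstar)
        (Matrix (Fin N) (Fin N) ℂ) G) x).Reg335 c35 α₀ U → PlaqLawY x ιB cP U := by
  haveI : Nonempty (Fin N) := ⟨⟨0, by omega⟩⟩
  intro h
  exact not_plaqLawY_halfCfg x ιB hd1 hN hG1 hg z hz (h _ _ (reg335C_extraYPb_halfCfg_of_le (N := N) x hg c35 le_rfl))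

/-- ★★★ **THE DISPLAYED BINDER `hplaq` OF `B9SectBStepUOfMembersR.sectBStepU_C37GY_unitary_of_members` AT `P := extraYPb`, NEGATED, VERBATIM SHAPE** — given ONE
member `j₀` of the family with a site of block scale `s`, `cP < 2·L^{2s}` (`N ≥ 2`, `d + 1 ≥ 2`, `G ∋ gSU N` contracting).  The GUARDED binder of
`B9SectBStepUGuardedR` (and its discharge `plaqLawY_of_reg335PlaqY ∘ hreg335P_extraYPb`) is the inhabited reading.
[cite: Balaban1985BackgroundPropagators, Thm 3.1 p.397, p.404, (3.35) p.396] -/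
theorem not_hplaq_classKeyed {J : Type} (f : J → MemberY d ℓ hd hL b₀ b₁ Mstar) (ιB : ∀ j : J, BlkY (f j).toKIdx → IBondY (f j).toKIdx) (j₀ : J)
    (hd1 : 1 ≤ d) (hN : 2 ≤ N) {G : Subgroup (Matrix (Fin N) (Fin N) ℂ)ˣ} (hG1 : ∀ u : (Matrix (Fin N) (Fin N) ℂ)ˣ, u ∈ G → ‖(u : Matrix (Fin N) (Fin N) ℂ)‖ ≤ 1)
    (hg : gSU N ∈ G) (c35 : ℝ) {cP : ℝ} (z : SiteY (f j₀).toKIdx) (hz : cP < 2 * ((geo9Y (f j₀)).L ^ (geo9Y (f j₀)).scale (blkC (f j₀).toKIdx (ιB j₀) z)) ^ 2) :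
    ¬ ∀ (j : J) (α₀ : ℝ) (U : CfgY (Matrix (Fin N) (Fin N) ℂ) (f j).toKIdx),
      (bg9YC (Matrix (Fin N) (Fin N) ℂ) G (extraYPb (d := d) (ℓ := ℓ) (hd := hd) (hL := hL) (b₀ := b₀) (b₁ := b₁) (Mstar := Mstar)
        (Matrix (Fin N) (Fin N) ℂ) G) (f j)).Reg335 c35 α₀ U → PlaqLawY (f j) (ιB j) cP U :=
  fun h => not_hplaq_unguarded (N := N) (f j₀) (ιB j₀) hd1 hN hG1 hg c35 z hz (h j₀)

end NotInhabited

end Literature.MathematicalPhysics.QuantumFieldTheory.Balaban1983to89.B9SectBL2PlaqLawUnguardedNotInhabited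

end
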